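import Summits.CriticalPhenomena.SAWScalingLimit.Theses.SAWTrackTransport
import Summits.CriticalPhenomena.SAWScalingLimit.Theses.SAWCompassLattice
import Summits.CriticalPhenomena.SAWScalingLimit.Theorems.SAWCompassLatticeSurfaceUniversalityTollReduction
import Summits.CriticalPhenomena.SAWScalingLimit.Theorems.SAWCompassLatticeCompassSLEExact

/-!
# `YBtoUniform` (stmt-CriticalPhenomena-16966) is, inside its own route, the summit conjunct

Crux-strategist census fact for the crux `Summit.CriticalPhenomena.SAWScalingLimit.Theses.SAWTrackTransport.YBtoUniform`
(route `SAWTrackTransport`, rank 6; "YB → uniform `ℤ²` toll": GM's critical square-tiling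
Yang–Baxter law `ybLaw (π/2)` and the critical `δℤ²` law `SAW.law` merge on bounded continuous test
functions of `CurveClass ℂ`). Kernel-checked statements, all `sorry`-free (landed verbatim from the 16966 strategist's
`Cruxes/YBtoUniform/SummitEquivalent.lean` by the lead c2 of the sibling crux 6964, minus the part landed meanwhile):

* (landed meanwhile by the `CompassSLE` lead as `SAWCompassLatticeCompassSLE.ybSquareSLE_of_trackTransport`,
  `…CompassSLEExact.lean`, and REUSED here:) **the route minus its toll supplies `YBSquareSLE`** — the
  five other cruxes of `SAWTrackTransport` (`AngleUniversality`, `YBLimitExists`, `AxiomsOfLimit`,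
  `RStarRot`, `MirrorRotation`) prove chordal SLE(8/3) convergence of the critical square-tiling
  Yang–Baxter walk for EVERY port endpoint approximation — verbatim the item
  `SAWCompassLattice.YBSquareSLE` (stmt-CriticalPhenomena-6967); the registered stub
  `stub_ybSquareSLEOfTrackTransport` of stmt-16966 is that landed theorem (same statement).
* `ybToUniform_of_sawScalingLimit` — **the summit pays the toll**: `YBSquareSLE → SAWScalingLimit →
  YBtoUniform` (two families converging to chordal SLE(8/3) curves of one Dobrushin domain merge:
  `Toll.tendsto_sub_of_sle`, SLE(8/3) in `D` being ONE law).
* `ybToUniform_iff_sawScalingLimit` — with the landed `Toll.sawScalingLimit_of_toll`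
  (`YBSquareSLE → YBtoUniform → SAWScalingLimit`): **given `YBSquareSLE`, the toll `YBtoUniform` is
  EQUIVALENT to the sub-problem statement `SAWScalingLimit`**; and its in-route form
  `ybToUniform_iff_sawScalingLimit_of_trackTransport`: given the five other cruxes of the route, the
  sixth is literally the summit conjunct.

Reading (census, `Cruxes/YBtoUniform/STRATEGY-CENSUS.md`): any line for this crux that uses the
route's own context (the Yang–Baxter side converges) is a proof of `SAWScalingLimit`; any line that
does not is finite-mesh universality between two critical face-weight points of the square lattice
(the registered line `Lines/birth.lean`: tightness 1881 + Lipschitz legs), for which no mechanism is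
in print. Nothing here is specific to SLE beyond uniqueness in law; no new hypothesis is introduced.
-/

noncomputable section

namespace Summit.CriticalPhenomena.SAWScalingLimit.Theorems.YBtoUniform.SummitEquivalent

open MeasureTheory Filter Topology Set
open scoped NNReal ENNReal
open Literature.Probability.RandomPlanarGeometry
open Literature.Probability.RandomPlanarGeometry.SAW
open Literature.Probability.RandomPlanarGeometry.SAW.YangBaxter
open Literature.Probability.LatticeModels (Site)
open Summit.CriticalPhenomena.SAWScalingLimit.Theses
open Summit.CriticalPhenomena.SAWScalingLimit.Theses.SAWTrackTransport
open Summit.CriticalPhenomena.SAWScalingLimit.Theorems (SAWCompassLatticeCompassSLE.ybSquareSLE_of_trackTransport)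

/-- **The summit pays the toll.** If GM's critical square-tiling Yang–Baxter walk converges to chordal
SLE(8/3) (`YBSquareSLE`, stmt-6967) and the critical `δℤ²` SAW does too (`SAWScalingLimit`, the
sub-problem statement), then the two finite-mesh laws merge on every bounded continuous test
function: both converge to SLE(8/3) curves of `D`, and SLE(8/3) in `D` is one law
(`Toll.tendsto_sub_of_sle`). [folklore] -/
theorem ybToUniform_of_sawScalingLimit (hY : SAWCompassLattice.YBSquareSLE)
    (hS : _root_.SAWScalingLimit) : YBtoUniform := by
  intro D a b a' b' hab happ f
  obtain ⟨Γ₁, hΓ₁, -, hT₁⟩ := hS D a b hab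
  obtain ⟨Γ₂, hΓ₂, -, hT₂⟩ := hY D a' b' happ
  exact SurfaceUniversality.Toll.tendsto_sub_of_sle hΓ₁ hΓ₂ hT₁ hT₂ f

/-- **Given `YBSquareSLE`, the toll is the summit**: `YBtoUniform ↔ SAWScalingLimit`
(`→`: the landed toll reduction `Toll.sawScalingLimit_of_toll`; `←`: `ybToUniform_of_sawScalingLimit`).
[folklore] -/
theorem ybToUniform_iff_sawScalingLimit (hY : SAWCompassLattice.YBSquareSLE) :
    YBtoUniform ↔ _root_.SAWScalingLimit :=
  ⟨SurfaceUniversality.Toll.sawScalingLimit_of_toll hY, ybToUniform_of_sawScalingLimit hY⟩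

/-- **In-route form**: given the five other cruxes of route `SAWTrackTransport`, its sixth crux
`YBtoUniform` is EQUIVALENT to the sub-problem statement `SAWScalingLimit`. [folklore] -/
theorem ybToUniform_iff_sawScalingLimit_of_trackTransport (h₂ : AngleUniversality)
    (h₃ : YBLimitExists) (h₄ : AxiomsOfLimit) (h₅ : RStarRot) (h₇ : MirrorRotation) :
    YBtoUniform ↔ _root_.SAWScalingLimit :=
  ybToUniform_iff_sawScalingLimit
    (SAWCompassLatticeCompassSLE.ybSquareSLE_of_trackTransport h₂ h₃ h₄ h₅ h₇)

/-- The deciding theorem recovered (sanity check that nothing was lost): the six cruxes give the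
summit conjunct, now factored through `YBSquareSLE`. [folklore] -/
theorem sawScalingLimit_of_cruxes (h₂ : AngleUniversality) (h₃ : YBLimitExists)
    (h₄ : AxiomsOfLimit) (h₅ : RStarRot) (h₆ : YBtoUniform) (h₇ : MirrorRotation) :
    _root_.SAWScalingLimit :=
  (ybToUniform_iff_sawScalingLimit_of_trackTransport h₂ h₃ h₄ h₅ h₇).1 h₆

/-! ### Registered stubs of stmt-CriticalPhenomena-16966 (one-line signatures, proved verbatim; the fourth,
`stub_ybSquareSLEOfTrackTransport`, IS the landed `SAWCompassLatticeCompassSLE.ybSquareSLE_of_trackTransport`) -/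

/-- Registered stub `stub_summitPaysToll`: `YBSquareSLE → SAWScalingLimit → YBtoUniform`.
[folklore] -/
theorem stub_summitPaysToll : SAWCompassLattice.YBSquareSLE → _root_.SAWScalingLimit → SAWTrackTransport.YBtoUniform :=
  ybToUniform_of_sawScalingLimit

/-- Registered stub `stub_tollIffSummit`: given `YBSquareSLE`, the toll is the summit conjunct.
[folklore] -/
theorem stub_tollIffSummit : SAWCompassLattice.YBSquareSLE → (SAWTrackTransport.YBtoUniform ↔ _root_.SAWScalingLimit) :=
  ybToUniform_iff_sawScalingLimit

/-- Registered stub `stub_tollIffSummitInRoute`: given the five other cruxes of `SAWTrackTransport`,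
the toll is the summit conjunct. [folklore] -/
theorem stub_tollIffSummitInRoute : SAWTrackTransport.AngleUniversality → SAWTrackTransport.YBLimitExists → SAWTrackTransport.AxiomsOfLimit → SAWTrackTransport.RStarRot → SAWTrackTransport.MirrorRotation → (SAWTrackTransport.YBtoUniform ↔ _root_.SAWScalingLimit) :=
  ybToUniform_iff_sawScalingLimit_of_trackTransport

end Summit.CriticalPhenomena.SAWScalingLimit.Theorems.YBtoUniform.SummitEquivalent

end
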